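import Summits.QuantumFields.QCD.Theorems.QuarksAsStableActionStableActionBridgeSliceKronDict
import Summits.QuantumFields.QCD.Theorems.QuarksAsStableActionStableActionBridgeSliceMassHopDict
import Summits.QuantumFields.QCD.Theorems.QuarksAsStableActionStableActionBridgeTimeSliceKineticDict
import Summits.QuantumFields.QCD.Theorems.QuarksAsStableActionStableActionBridgeSliceGammaConjugation

/-!
# Dictionary: the dressed one-step core of the Wilson determinant is Smit's `V M_F V⁻¹`
(crux `QuarksAsStableAction.StableActionBridge`, item stmt-QuantumFields-9737, line `Sketch`;
registered stub `dressedCore_timeSlice_eq` of the lead skeleton)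

Lüscher's transfer-matrix form of the Wilson fermion determinant (`wilson_det_transfer_form`)
produces, on every time slice `t` of a four-torus `SU(3)` gauge field `U` (one flavour of bare mass
`m`, fundamental representation), the Hermitian DRESSED CORE

  `M_t = (1 + P⁺ (A − B̂) P⁻) (B̂ P⁺ + B̂⁻¹ P⁻) (1 − P⁻ (A − B̂) P⁺)`

on the index `TorusSite 3 L × Fin 3 × Fin 4` (site, colour, spin), written with explicit
`Matrix.of` lifts: `P± = 1 ⊗ ½(1 ± γ₄)` (`γ₄ := euclideanGamma 0`, Euclidean time is coordinate
`0`), `A` the slice-`t` block of the `r = 1` Wilson–Dirac operator, `B̂ = B ⊗ 1₄` the spin lift of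
its spin-blind block `B`.  Smit's one-particle matrix of the fermionic transfer operator
(*Introduction to Quantum Fields on a Lattice*, §6.5 (6.91)) of the slice configuration
`U_t : e ↦ U((t, e.1), e.2.succ)` is `M_F = (1 − N)(A⁻¹ ⊗ P⁺ + A ⊗ P⁻)(1 − Nᴴ)`
(`fermionSliceMatrix`) on `SliceQuarkVar 1 L = Fin 1 × (TorusSite 3 L × Fin 3 × Fin 4)`.

`dressedCore_timeSlice_eq`: `M_t` is the reindexing, along
`Equiv.uniqueProd _ (Fin 1) : Fin 1 × X ≃ X`, of `V M_F V⁻¹` with the unitary spin rotation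
`V = 1 ⊗ γ₄γ₅`, `V⁻¹ = 1 ⊗ γ₅γ₄`.  The proof has three layers.

* DICTIONARY (sub-namespace `DressedCoreDict`): `P± = reindex (1 ⊗ P±)`
  (`liftProjPlus_eq_reindex`, `liftProjMinus_eq_reindex`, from `sliceKron_one_spin_apply`),
  `B̂ = reindex (A(U_t) ⊗ 1)` (`spinLift_eq_reindex`, from `sliceKron_spinDiag_apply` and
  `sliceMassHop_timeSlice_apply`), `A − B̂ = reindex ((1 ⊗ γ₄) D)`
  (`kineticRemainder_eq_reindex`, from `timeSlice_kinetic_dictionary` and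
  `sliceKron_gammaZero_mul_sliceDiracKinetic`).
* TRANSPORT: `reindex e e` is the algebra isomorphism `Matrix.reindexAlgEquiv ℂ ℂ e`, so it passes
  through the dressed-core expression (`reindex_dressedCore`) and through `⁻¹`
  (`Matrix.inv_reindex`); `(B ⊗ 1)⁻¹ = B⁻¹ ⊗ 1` unconditionally (`sliceKron_one_inv`, via
  `Matrix.inv_kronecker`).
* ALGEBRA in the `sliceKron` vocabulary: `P⁺γ₄ = P⁺`, `P⁻γ₄ = −P⁻`, hence
  `P⁺(γ₄D)P⁻ = P⁺DP⁻ = Nᴴ` and `P⁻(γ₄D)P⁺ = −N`, and `(A ⊗ 1)P⁺ = A ⊗ P⁺`,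
  `(A⁻¹ ⊗ 1)P⁻ = A⁻¹ ⊗ P⁻`; the dressed core becomes `(1 + Nᴴ)(A ⊗ P⁺ + A⁻¹ ⊗ P⁻)(1 + N)`,
  which is `V M_F V⁻¹` by the landed `fermionSliceMatrix_conj_gamma05`
  (`dressedCore_sliceKron_eq`).

No mass hypothesis is needed (both sides use Mathlib's total `Matrix.inv`).  Pure theorem file
(no definitions).

[cite: Smit2023, §6.5 (6.74)–(6.77) and (6.91)] [cite: Luscher1977, pp. 283–292]
-/

noncomputable section

namespace Summit.QuantumFields.QCD.Cruxes.StableActionBridge.Sketch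

open MeasureTheory Matrix Literature.MathematicalPhysics.QuantumFieldTheory
  Literature.MathematicalPhysics.QuantumLattice
open Literature.Probability.LatticeModels (TorusSite)

namespace DressedCoreDict

open scoped Kronecker

/-! ### Transport along a reindexing -/

/-- `Matrix.reindex e e` passes through the dressed-core expression
`(1 + P C Q)(K P + K' Q)(1 − Q C P)` (it is the algebra isomorphism `Matrix.reindexAlgEquiv`).
[folklore] -/
theorem reindex_dressedCore {m n : Type*} [Fintype m] [Fintype n] [DecidableEq m] [DecidableEq n]
    (e : m ≃ n) (P Q C K K' : Matrix m m ℂ) :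
    Matrix.reindex e e ((1 + P * C * Q) * (K * P + K' * Q) * (1 - Q * C * P)) =
      (1 + Matrix.reindex e e P * Matrix.reindex e e C * Matrix.reindex e e Q) *
        (Matrix.reindex e e K * Matrix.reindex e e P + Matrix.reindex e e K' * Matrix.reindex e e Q) *
        (1 - Matrix.reindex e e Q * Matrix.reindex e e C * Matrix.reindex e e P) := by
  simp only [← Matrix.coe_reindexAlgEquiv ℂ ℂ e, map_mul, map_add, map_sub, map_one]

variable {Nf S : ℕ} [NeZero S]

/-- `(B ⊗ 1₄)⁻¹ = B⁻¹ ⊗ 1₄` for Mathlib's total matrix inverse (no invertibility needed: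
`Matrix.inv_kronecker` and `Matrix.inv_reindex` hold unconditionally). [folklore] -/
theorem sliceKron_one_inv (B : Matrix (SliceColourVar Nf S) (SliceColourVar Nf S) ℂ) :
    (sliceKron B (1 : Matrix (Fin 4) (Fin 4) ℂ))⁻¹ = sliceKron B⁻¹ 1 := by
  rw [SliceNilpotent.sliceKron_eq_reindex, SliceNilpotent.sliceKron_eq_reindex,
    Matrix.coe_reindexAlgEquiv, Matrix.inv_reindex, Matrix.inv_kronecker, inv_one]

/-! ### The spin algebra: `P±γ₄ = ±P±` and its lift -/

/-- `P⁺ γ₄ = P⁺` (`P⁺ = ½(1 + γ₄)`, `γ₄² = 1`). [folklore] -/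
theorem timeProjPlus_mul_gammaZero : timeProjPlus * euclideanGamma 0 = timeProjPlus := by
  rw [timeProjPlus, Matrix.smul_mul, Matrix.add_mul, Matrix.one_mul, euclideanGamma_mul_self,
    add_comm]

/-- `P⁻ γ₄ = −P⁻` (`P⁻ = ½(1 − γ₄)`, `γ₄² = 1`). [folklore] -/
theorem timeProjMinus_mul_gammaZero : timeProjMinus * euclideanGamma 0 = -timeProjMinus := by
  rw [timeProjMinus, Matrix.smul_mul, Matrix.sub_mul, Matrix.one_mul, euclideanGamma_mul_self,
    ← smul_neg, neg_sub]

/-- `(1 ⊗ P⁺)(1 ⊗ γ₄) = 1 ⊗ P⁺` on the slice quark modes. [folklore] -/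
theorem sliceKron_timeProjPlus_mul_gammaZero :
    sliceKron (Nf := Nf) (S := S) 1 timeProjPlus * sliceKron 1 (euclideanGamma 0) =
      sliceKron 1 timeProjPlus := by
  rw [SliceNilpotent.sliceKron_mul, Matrix.mul_one, timeProjPlus_mul_gammaZero]

/-- `(1 ⊗ P⁻)(1 ⊗ γ₄) = −(1 ⊗ P⁻)` on the slice quark modes. [folklore] -/
theorem sliceKron_timeProjMinus_mul_gammaZero :
    sliceKron (Nf := Nf) (S := S) 1 timeProjMinus * sliceKron 1 (euclideanGamma 0) =
      -sliceKron 1 timeProjMinus := by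
  rw [SliceNilpotent.sliceKron_mul, Matrix.mul_one, timeProjMinus_mul_gammaZero,
    SliceNilpotent.sliceKron_neg_right]

/-- `(1 ⊗ P⁺) ((1 ⊗ γ₄) D) (1 ⊗ P⁻) = (1 ⊗ P⁺) D (1 ⊗ P⁻) = Nᴴ`.
[cite: Smit2023, §6.5 (6.84)] -/
theorem projPlus_gammaKinetic_projMinus (V : GaugeConfig 3 S (Matrix.specialUnitaryGroup (Fin 3) ℂ)) :
    sliceKron (Nf := Nf) (S := S) 1 timeProjPlus * (sliceKron 1 (euclideanGamma 0) * sliceDiracKinetic V) *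
        sliceKron 1 timeProjMinus = (sliceNilp V)ᴴ := by
  rw [← Matrix.mul_assoc, sliceKron_timeProjPlus_mul_gammaZero,
    SliceGammaConjugation.sliceNilp_conjTranspose]

/-- `(1 ⊗ P⁻) ((1 ⊗ γ₄) D) (1 ⊗ P⁺) = −(1 ⊗ P⁻) D (1 ⊗ P⁺) = −N`.
[cite: Smit2023, §6.5 (6.84)] -/
theorem projMinus_gammaKinetic_projPlus (V : GaugeConfig 3 S (Matrix.specialUnitaryGroup (Fin 3) ℂ)) :
    sliceKron (Nf := Nf) (S := S) 1 timeProjMinus * (sliceKron 1 (euclideanGamma 0) * sliceDiracKinetic V) *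
        sliceKron 1 timeProjPlus = -sliceNilp V := by
  rw [← Matrix.mul_assoc, sliceKron_timeProjMinus_mul_gammaZero, Matrix.neg_mul, Matrix.neg_mul,
    sliceNilp]

/-- **The dressed core in `sliceKron` vocabulary is `V M_F V⁻¹`.**  With `P± = 1 ⊗ P±`,
`γ = 1 ⊗ γ₄`, `D = sliceDiracKinetic V`, `Â = A(V) ⊗ 1₄`:
`(1 + P⁺(γD)P⁻)(ÂP⁺ + Â⁻¹P⁻)(1 − P⁻(γD)P⁺) = (1 ⊗ γ₄γ₅) M_F(V) (1 ⊗ γ₅γ₄)`, because the left side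
is `(1 + Nᴴ)(A ⊗ P⁺ + A⁻¹ ⊗ P⁻)(1 + N)` (`fermionSliceMatrix_conj_gamma05`).
[cite: Smit2023, §6.5 (6.91)] [cite: Luscher1977, pp. 283–292] -/
theorem dressedCore_sliceKron_eq (V : GaugeConfig 3 S (Matrix.specialUnitaryGroup (Fin 3) ℂ))
    (mq : Fin Nf → ℝ) :
    (1 + sliceKron 1 timeProjPlus * (sliceKron 1 (euclideanGamma 0) * sliceDiracKinetic V) *
          sliceKron 1 timeProjMinus) *
        (sliceKron (sliceMassHop V mq) 1 * sliceKron 1 timeProjPlus +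
          (sliceKron (sliceMassHop V mq) 1)⁻¹ * sliceKron 1 timeProjMinus) *
        (1 - sliceKron 1 timeProjMinus * (sliceKron 1 (euclideanGamma 0) * sliceDiracKinetic V) *
          sliceKron 1 timeProjPlus) =
      sliceKron (Nf := Nf) (S := S) 1 (euclideanGamma 0 * gammaFive) * fermionSliceMatrix V mq *
        sliceKron 1 (gammaFive * euclideanGamma 0) := by
  rw [fermionSliceMatrix_conj_gamma05, projPlus_gammaKinetic_projMinus,
    projMinus_gammaKinetic_projPlus, sub_neg_eq_add, sliceKron_one_inv,
    SliceNilpotent.sliceKron_mul, SliceNilpotent.sliceKron_mul, Matrix.mul_one, Matrix.mul_one,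
    Matrix.one_mul, Matrix.one_mul]

/-! ### Dictionary: the explicit lifts of `wilson_det_transfer_form` as reindexed `sliceKron`s -/

/-- **`P⁺ = reindex (1 ⊗ P⁺)`**: the colour-blind lift of `½(1 + γ₄)` on
`TorusSite 3 L × Fin 3 × Fin 4` is the one-flavour `sliceKron 1 timeProjPlus` reindexed along
`Fin 1 × X ≃ X`. [cite: Smit2023, §6.5 (6.77)] -/
theorem liftProjPlus_eq_reindex (L : ℕ) [NeZero L] :
    (Matrix.of fun a b : TorusSite 3 L × Fin 3 × Fin 4 =>
        if a.1 = b.1 ∧ a.2.1 = b.2.1 then ((1 / 2 : ℂ) • (1 + euclideanGamma 0)) a.2.2 b.2.2 else 0) =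
      Matrix.reindex (Equiv.uniqueProd (TorusSite 3 L × Fin 3 × Fin 4) (Fin 1))
        (Equiv.uniqueProd (TorusSite 3 L × Fin 3 × Fin 4) (Fin 1))
        (sliceKron (Nf := 1) (S := L) 1 timeProjPlus) := by
  ext a b
  rw [Matrix.reindex_apply, Matrix.submatrix_apply, Equiv.uniqueProd_symm_apply,
    Equiv.uniqueProd_symm_apply, Fin.default_eq_zero, sliceKron_one_spin_apply, Matrix.of_apply]
  rfl

/-- **`P⁻ = reindex (1 ⊗ P⁻)`**: the colour-blind lift of `½(1 − γ₄)` on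
`TorusSite 3 L × Fin 3 × Fin 4` is the one-flavour `sliceKron 1 timeProjMinus` reindexed along
`Fin 1 × X ≃ X`. [cite: Smit2023, §6.5 (6.77)] -/
theorem liftProjMinus_eq_reindex (L : ℕ) [NeZero L] :
    (Matrix.of fun a b : TorusSite 3 L × Fin 3 × Fin 4 =>
        if a.1 = b.1 ∧ a.2.1 = b.2.1 then ((1 / 2 : ℂ) • (1 - euclideanGamma 0)) a.2.2 b.2.2 else 0) =
      Matrix.reindex (Equiv.uniqueProd (TorusSite 3 L × Fin 3 × Fin 4) (Fin 1))
        (Equiv.uniqueProd (TorusSite 3 L × Fin 3 × Fin 4) (Fin 1))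
        (sliceKron (Nf := 1) (S := L) 1 timeProjMinus) := by
  ext a b
  rw [Matrix.reindex_apply, Matrix.submatrix_apply, Equiv.uniqueProd_symm_apply,
    Equiv.uniqueProd_symm_apply, Fin.default_eq_zero, sliceKron_one_spin_apply, Matrix.of_apply]
  rfl

/-- **`B̂ = reindex (A(U_t) ⊗ 1₄)`**: the spin-diagonal lift of the spin-blind slice block `B` of
the Wilson determinant at time `t` is Smit's `sliceKron (sliceMassHop U_t mq) 1` of the slice
configuration `U_t : e ↦ U((t, e.1), e.2.succ)`, one flavour of mass `m`, reindexed along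
`Fin 1 × X ≃ X`. [cite: Smit2023, §6.5 (6.74)] -/
theorem spinLift_eq_reindex (L : ℕ) [NeZero L]
    (U : GaugeConfig 4 L (Matrix.specialUnitaryGroup (Fin 3) ℂ)) (m : ℝ) (t : ZMod L) :
    let B : Matrix (TorusSite 3 L × Fin 3) (TorusSite 3 L × Fin 3) ℂ := Matrix.of fun a b =>
      (if a = b then ((m + 4 : ℝ) : ℂ) else 0) - (1 / 2 : ℂ) * ∑ j : Fin 3,
        ((if b.1 = Literature.MathematicalPhysics.QuantumFieldTheory.Site.shift a.1 j then
            fundamentalRep (Fin 3) (U ((Fin.cons t a.1 : TorusSite 4 L), j.succ)) a.2 b.2 else 0) +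
          (if a.1 = Literature.MathematicalPhysics.QuantumFieldTheory.Site.shift b.1 j then
            fundamentalRep (Fin 3) (U ((Fin.cons t b.1 : TorusSite 4 L), j.succ))⁻¹ a.2 b.2 else 0));
    (Matrix.of fun a b : TorusSite 3 L × Fin 3 × Fin 4 =>
        if a.2.2 = b.2.2 then B (a.1, a.2.1) (b.1, b.2.1) else 0) =
      Matrix.reindex (Equiv.uniqueProd (TorusSite 3 L × Fin 3 × Fin 4) (Fin 1))
        (Equiv.uniqueProd (TorusSite 3 L × Fin 3 × Fin 4) (Fin 1))
        (sliceKron (sliceMassHop (fun e : Edge 3 L => U ((Fin.cons t e.1 : TorusSite 4 L), e.2.succ))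
          (fun _ : Fin 1 => m)) 1) := by
  intro B
  ext a b
  rw [Matrix.reindex_apply, Matrix.submatrix_apply, Equiv.uniqueProd_symm_apply,
    Equiv.uniqueProd_symm_apply, Fin.default_eq_zero, sliceKron_spinDiag_apply,
    sliceMassHop_timeSlice_apply, Matrix.of_apply]
  rfl

/-- **`A − B̂ = reindex ((1 ⊗ γ₄) D(U_t))`**: the kinetic remainder of the slice-`t` block of the
`r = 1` Wilson–Dirac operator is `½∑ⱼ (W_j − W_jᴴ) ⊗ γ_j = (1 ⊗ γ₄) D` for Smit's
`D = ½∑ⱼ (W_j − W_jᴴ) ⊗ γ₄γ_j` (`sliceDiracKinetic`) of the slice configuration `U_t`, reindexed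
along `Fin 1 × X ≃ X`. [cite: Smit2023, §6.5 (6.74)–(6.75)] -/
theorem kineticRemainder_eq_reindex (L : ℕ) [NeZero L]
    (U : GaugeConfig 4 L (Matrix.specialUnitaryGroup (Fin 3) ℂ)) (m : ℝ) (t : ZMod L) :
    let A : Matrix (TorusSite 3 L × Fin 3 × Fin 4) (TorusSite 3 L × Fin 3 × Fin 4) ℂ :=
      Matrix.of fun a b => (if a = b then ((m + 4 * 1 : ℝ) : ℂ) else 0) - (1 / 2 : ℂ) * ∑ j : Fin 3,
        ((if b.1 = Literature.MathematicalPhysics.QuantumFieldTheory.Site.shift a.1 j then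
            (((1 : ℝ) : ℂ) • (1 : Matrix (Fin 4) (Fin 4) ℂ) - euclideanGamma j.succ) a.2.2 b.2.2 *
              fundamentalRep (Fin 3) (U ((Fin.cons t a.1 : TorusSite 4 L), j.succ)) a.2.1 b.2.1 else 0) +
          (if a.1 = Literature.MathematicalPhysics.QuantumFieldTheory.Site.shift b.1 j then
            (((1 : ℝ) : ℂ) • (1 : Matrix (Fin 4) (Fin 4) ℂ) + euclideanGamma j.succ) a.2.2 b.2.2 *
              fundamentalRep (Fin 3) (U ((Fin.cons t b.1 : TorusSite 4 L), j.succ))⁻¹ a.2.1 b.2.1 else 0));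
    let B : Matrix (TorusSite 3 L × Fin 3) (TorusSite 3 L × Fin 3) ℂ := Matrix.of fun a b =>
      (if a = b then ((m + 4 : ℝ) : ℂ) else 0) - (1 / 2 : ℂ) * ∑ j : Fin 3,
        ((if b.1 = Literature.MathematicalPhysics.QuantumFieldTheory.Site.shift a.1 j then
            fundamentalRep (Fin 3) (U ((Fin.cons t a.1 : TorusSite 4 L), j.succ)) a.2 b.2 else 0) +
          (if a.1 = Literature.MathematicalPhysics.QuantumFieldTheory.Site.shift b.1 j then
            fundamentalRep (Fin 3) (U ((Fin.cons t b.1 : TorusSite 4 L), j.succ))⁻¹ a.2 b.2 else 0));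
    let Bh : Matrix (TorusSite 3 L × Fin 3 × Fin 4) (TorusSite 3 L × Fin 3 × Fin 4) ℂ :=
      Matrix.of fun a b => if a.2.2 = b.2.2 then B (a.1, a.2.1) (b.1, b.2.1) else 0;
    A - Bh =
      Matrix.reindex (Equiv.uniqueProd (TorusSite 3 L × Fin 3 × Fin 4) (Fin 1))
        (Equiv.uniqueProd (TorusSite 3 L × Fin 3 × Fin 4) (Fin 1))
        (sliceKron (Nf := 1) 1 (euclideanGamma 0) *
          sliceDiracKinetic (fun e : Edge 3 L => U ((Fin.cons t e.1 : TorusSite 4 L), e.2.succ))) := by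
  intro A B Bh
  ext p q
  rw [Matrix.reindex_apply, Matrix.submatrix_apply, Equiv.uniqueProd_symm_apply,
    Equiv.uniqueProd_symm_apply, Fin.default_eq_zero, sliceKron_gammaZero_mul_sliceDiracKinetic]
  exact timeSlice_kinetic_dictionary L U m t p q

end DressedCoreDict

/-- **Stub `dressedCore_timeSlice_eq` of line `Sketch`: the dressed one-step core of the Wilson
determinant is Smit's `V M_F V⁻¹`.**  For a four-torus `SU(3)` gauge field `U`, one flavour of
bare mass `m` and a time `t`, with the explicit slice matrices of `wilson_det_transfer_form`
(`P± = 1 ⊗ ½(1 ± γ₄)`, `A` the slice-`t` block of the `r = 1` Wilson–Dirac operator, `B̂ = B ⊗ 1₄`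
the spin lift of its spin-blind block), the dressed core
`(1 + P⁺(A − B̂)P⁻)(B̂P⁺ + B̂⁻¹P⁻)(1 − P⁻(A − B̂)P⁺)` is the reindexing along `Fin 1 × X ≃ X` of
`(1 ⊗ γ₄γ₅) M_F(U_t) (1 ⊗ γ₅γ₄)`, `M_F` Smit's one-particle fermionic transfer matrix (6.91) of the
slice configuration `U_t : e ↦ U((t, e.1), e.2.succ)` (Lüscher's one-step matrix vs Smit's, related
by the unitary spin rotation `γ₄γ₅`).
[cite: Smit2023, §6.5 (6.91)] [cite: Luscher1977, pp. 283–292] -/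
theorem dressedCore_timeSlice_eq : ∀ (L : ℕ) [NeZero L] (U : GaugeConfig 4 L (Matrix.specialUnitaryGroup (Fin 3) ℂ)) (m : ℝ) (t : ZMod L), let Pp : Matrix (TorusSite 3 L × Fin 3 × Fin 4) (TorusSite 3 L × Fin 3 × Fin 4) ℂ := Matrix.of fun a b => if a.1 = b.1 ∧ a.2.1 = b.2.1 then ((1 / 2 : ℂ) • (1 + euclideanGamma 0)) a.2.2 b.2.2 else 0; let Pm : Matrix (TorusSite 3 L × Fin 3 × Fin 4) (TorusSite 3 L × Fin 3 × Fin 4) ℂ := Matrix.of fun a b => if a.1 = b.1 ∧ a.2.1 = b.2.1 then ((1 / 2 : ℂ) • (1 - euclideanGamma 0)) a.2.2 b.2.2 else 0; let A : Matrix (TorusSite 3 L × Fin 3 × Fin 4) (TorusSite 3 L × Fin 3 × Fin 4) ℂ := Matrix.of fun a b => (if a = b then ((m + 4 * 1 : ℝ) : ℂ) else 0) - (1 / 2 : ℂ) * ∑ j : Fin 3, ((if b.1 = Literature.MathematicalPhysics.QuantumFieldTheory.Site.shift a.1 j then (((1 : ℝ) : ℂ) • (1 : Matrix (Fin 4) (Fin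 4) ℂ) - euclideanGamma j.succ) a.2.2 b.2.2 * fundamentalRep (Fin 3) (U ((Fin.cons t a.1 : TorusSite 4 L), j.succ)) a.2.1 b.2.1 else 0) + (if a.1 = Literature.MathematicalPhysics.QuantumFieldTheory.Site.shift b.1 j then (((1 : ℝ) : ℂ) • (1 : Matrix (Fin 4) (Fin 4) ℂ) + euclideanGamma j.succ) a.2.2 b.2.2 * fundamentalRep (Fin 3) (U ((Fin.cons t b.1 : TorusSite 4 L), j.succ))⁻¹ a.2.1 b.2.1 else 0)); let B : Matrix (TorusSite 3 L × Fin 3) (TorusSite 3 L × Fin 3) ℂ := Matrix.of fun a b => (if a = b then ((m + 4 : ℝ) : ℂ) else 0) - (1 / 2 : ℂ) * ∑ j : Fin 3, ((if b.1 = Literature.MathematicalPhysics.QuantumFieldTheory.Site.shift a.1 j then fundamentalRep (Fin 3) (U ((Fin.cons t a.1 : TorusSite 4 L), j.succ)) a.2 b.2 else 0) + (if a.1 = Literature.MathematicalPhysics.QuantumFieldTheory.Site.shift b.1 j then fundamentalRep (Fin 3) (U ((Fin.cons t b.1 : TorusSite 4 L), j.succ))⁻¹ a.2 b.2 else 0));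 let Bh : Matrix (TorusSite 3 L × Fin 3 × Fin 4) (TorusSite 3 L × Fin 3 × Fin 4) ℂ := Matrix.of fun a b => if a.2.2 = b.2.2 then B (a.1, a.2.1) (b.1, b.2.1) else 0; (1 + Pp * (A - Bh) * Pm) * (Bh * Pp + Bh⁻¹ * Pm) * (1 - Pm * (A - Bh) * Pp) = Matrix.reindex (Equiv.uniqueProd (TorusSite 3 L × Fin 3 × Fin 4) (Fin 1)) (Equiv.uniqueProd (TorusSite 3 L × Fin 3 × Fin 4) (Fin 1)) (sliceKron (Nf := 1) 1 (euclideanGamma 0 * gammaFive) * fermionSliceMatrix (fun e : Edge 3 L => U ((Fin.cons t e.1 : TorusSite 4 L), e.2.succ)) (fun _ : Fin 1 => m) * sliceKron 1 (gammaFive * euclideanGamma 0)) := by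
  intro L _ U m t Pp Pm A B Bh
  have hPp : Pp = _ := DressedCoreDict.liftProjPlus_eq_reindex L
  have hPm : Pm = _ := DressedCoreDict.liftProjMinus_eq_reindex L
  have hBh : Bh = Matrix.reindex (Equiv.uniqueProd (TorusSite 3 L × Fin 3 × Fin 4) (Fin 1))
      (Equiv.uniqueProd (TorusSite 3 L × Fin 3 × Fin 4) (Fin 1))
      (sliceKron (sliceMassHop (fun e : Edge 3 L => U ((Fin.cons t e.1 : TorusSite 4 L), e.2.succ))
        (fun _ : Fin 1 => m)) 1) :=
    DressedCoreDict.spinLift_eq_reindex L U m t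
  have hAB : A - Bh = Matrix.reindex (Equiv.uniqueProd (TorusSite 3 L × Fin 3 × Fin 4) (Fin 1))
      (Equiv.uniqueProd (TorusSite 3 L × Fin 3 × Fin 4) (Fin 1))
      (sliceKron (Nf := 1) 1 (euclideanGamma 0) *
        sliceDiracKinetic (fun e : Edge 3 L => U ((Fin.cons t e.1 : TorusSite 4 L), e.2.succ))) :=
    DressedCoreDict.kineticRemainder_eq_reindex L U m t
  rw [hAB, hBh, hPp, hPm, Matrix.inv_reindex, ← DressedCoreDict.reindex_dressedCore,
    DressedCoreDict.dressedCore_sliceKron_eq]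

end Summit.QuantumFields.QCD.Cruxes.StableActionBridge.Sketch

end
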